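import Summits.ResolutionOfSingularities.ResolutionOfSingularities.Theorems.HilbertSamuelEliminationSigmaMaxModificationsCorridor3ConfinedStubOfT23
import Summits.ResolutionOfSingularities.ResolutionOfSingularities.Theorems.HilbertSamuelEliminationSigmaMaxModificationsCorridor3HypersurfaceChart
import Summits.ResolutionOfSingularities.ResolutionOfSingularities.Theorems.HilbertSamuelEliminationSigmaMaxModificationsCorridor3EmbeddedTower
import HarnessLib

/-!
# Route `HilbertSamuelElimination`, crux `SigmaMaxModificationsCorridor3`
# (stmt-ResolutionOfSingularities-19249; child of `SigmaMaxModifications` stmt-…-18506),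
# line `tame_wild` v3.1 (confined form): the REGISTERED STUB `stub_confinedTameNu3_of_thor4`,
# BY NAME AND SIGNATURE, sorry-free

[OURS · L1 W4.2] **The confined tame transfer is a theorem.** The registered stub
`stub_confinedTameNu3_of_thor4` of the line of record `tame_wild` v3.1 (crux chain w42; lead
res-L1-w42-lead-1, skeleton registered on stmt-…-19249 2026-08-27T01:29Z, sha16 `7ebc2db7f00d2b97`):
given tame hypersurface order reduction in dimension `4` at the prime `p ≥ 5` (THOR₄, the
hypothesis — data-level `CentreSeq.IsResolutionOf` form — = `stub_thor4`, open in print, the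
`E = []`, `dim ≤ 4`, `m < p` specialisation of MarkedTransfer's `HypersurfaceOrderReduction`), a
CONFINED tame maximal Hilbert–Samuel stratum of a reduced threefold over a perfect field (a
regular-centred, `H`-monotone blow-up sequence `s` over `Y(ν)` whose top `ν`-stratum lies over
finitely many closed points) is eliminated by a `ν`-modification: `NuMod Y 3 3 ν`. Assembled by
res-L1-w42-stub-4's `confinedTameNu3_of_thor4_of_T23` (…Corridor3ConfinedStubOfT23.lean: lead-1's
assembly `confinedNu3_of_bricks_cs'` with T1′ = `Helpers.stub_T1_chartTransfer` p485554 and T4 =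
`Helpers.stub_T4_chartDictionary` p482357 discharged) from the two bricks of res-L1-w42-stub-2:
T2 = `Helpers.stub_T2_hypersurfaceChart_ker` (p482918, hypersurface chart at a closed stratum point)
and T3 = `Helpers.stub_T3_embeddedTower` (p485848, the embedded tower: strict transforms of the
effective Cartier hypersurface stay effective Cartier in the regular blown-up fourfolds). NOT a
statement of any manuscript under review; no claim beyond the kernel.

## Sources
* V. Cossart, U. Jannsen, S. Saito, LNM 2270 (2020), Def. 6.14, Rem. 6.24, Thm. 3.10 (1).
  [CossartJannsenSaito2020]
* E. Bierstone, D. Grigoriev, P. Milman, J. Włodarczyk, arXiv:1206.3090, Def. 3.1.3, Thm. 8.0.5.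
  [BierstoneGrigorievMilmanWlodarczyk2011]
* J. Kollár, *Lectures on Resolution of Singularities* (2007), 3.30.2–3.30.3. [Kollar2007]
-/

set_option linter.dupNamespace false -- mandated namespace of this single-conjunct summit

noncomputable section

open CategoryTheory AlgebraicGeometry TopologicalSpace Topology
open Literature.AlgebraicGeometry.Resolution Literature.RingTheory.HilbertSamuel

namespace Summit.ResolutionOfSingularities.ResolutionOfSingularities.Theorems.SigmaMaxModificationsCorridor3.TameWild

/-- **[OURS · L1 W4.2] The registered stub `stub_confinedTameNu3_of_thor4` of line `tame_wild`
v3.1 (crux `SigmaMaxModificationsCorridor3`, stmt-…-19249), by name and signature:** for a prime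
`p ≥ 5`, tame hypersurface order reduction on regular fourfolds at `p` (THOR₄, hypothesis) implies
that every CONFINED tame maximal Hilbert–Samuel stratum (`ν = hypersurfaceHF m`, `m < p`, `ν`
maximal, `ν ≠ Φ^{(3)}`, non-isolated) of a reduced separated threefold of finite type over a perfect
field of characteristic `p` is eliminated by a `ν`-modification. Proof:
`confinedTameNu3_of_thor4_of_T23` (stub-4/lead-1 assembly with T1′, T4 landed) applied to the bricks
T2 `Helpers.stub_T2_hypersurfaceChart_ker` and T3 `Helpers.stub_T3_embeddedTower`.
[cite: CossartJannsenSaito2020, Def. 6.14, Rem. 6.24] [cite: BierstoneGrigorievMilmanWlodarczyk2011, Thm. 8.0.5]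
[cite: Kollar2007, 3.30.3] -/
theorem stub_confinedTameNu3_of_thor4 :
    ∀ p : ℕ, p.Prime → 5 ≤ p →
      (∀ (k : Type) [Field k] [CharP k p] [PerfectField k] (Z : Scheme.{0})
        (h : Z ⟶ Spec (.of k)), IsSeparated h → LocallyOfFiniteType h → QuasiCompact h →
        IsIntegral Z → Scheme.IsRegular Z → topologicalKrullDim Z ≤ ((4 : ℕ) : WithBot ℕ∞) →
        ∀ (I : Z.IdealSheafData), I ≠ ⊥ → IsEffectiveCartier I → ∀ m : ℕ, 1 ≤ m → m < p →
          ∃ t : CentreSeq Z, t.IsResolutionOf (⟨I, [], m⟩ : MarkedIdeal Z)) →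
      ∀ (k : Type) [Field k] [CharP k p] [PerfectField k] (Y : Scheme.{0})
        (g : Y ⟶ Spec (.of k)), IsSeparated g → LocallyOfFiniteType g → QuasiCompact g →
        IsReduced Y → ((3 : ℕ) : WithBot ℕ∞) ≤ topologicalKrullDim Y →
        topologicalKrullDim Y ≤ ((3 : ℕ) : WithBot ℕ∞) →
        ∀ ν : ℕ → ℕ, Maximal (· ∈ Scheme.hsValues Y 3) ν → ν ≠ iterPSum 3 Phi →
          IsTameValue p ν →
          ¬ Disjoint (closure ((Scheme.regularLocus Y)ᶜ \ Scheme.hsStratum Y 3 ν))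
              (Scheme.hsStratum Y 3 ν) →
          ∀ s : CentreSeq Y, s.AllRegular → s.CentresOver (Scheme.hsStratum Y 3 ν) →
            (∀ x' : s.top, Scheme.hsFun s.top 3 x' ≤ Scheme.hsFun Y 3 (s.comp.base x')) →
            ((fun x' => s.comp.base x') '' Scheme.hsStratum s.top 3 ν).Finite →
            (∀ y ∈ (fun x' => s.comp.base x') '' Scheme.hsStratum s.top 3 ν,
              IsClosed ({y} : Set Y)) →
            NuMod Y 3 3 ν :=
  confinedTameNu3_of_thor4_of_T23 Helpers.stub_T2_hypersurfaceChart_ker Helpers.stub_T3_embeddedTower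

end Summit.ResolutionOfSingularities.ResolutionOfSingularities.Theorems.SigmaMaxModificationsCorridor3.TameWild

end
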